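import Summits.BirchSwinnertonDyer.BirchSwinnertonDyer.Theorems.GenusKolyvaginAtTwoPowDvdShaCardAtTwoRTLadderFrame
import HarnessLib

/-!
# Route `GenusKolyvaginAtTwo`, LINE 18 (L_T stmt-BirchSwinnertonDyer-23242), THE crux 3a⁗ — the TWIN-SIDE genus budget in SELMER
# currency (pen v4.5's second by-name-able piece): `[res⁻¹(Sel_n(Wd_K/K)) ⊓ ⨅_∞ : Sel_n(Wd/ℚ)] ≤ 2^{ord₂ C(Wd)}`, every level `n`

Seat `bsd-line-gk2-p3` g18 (cell `bsd-f1-sign2`), `--supports stmt-BirchSwinnertonDyer-23242` (helper; closes nothing).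
THEOREMS ONLY (no definition, no named fact, no `sorry`); BSD is not proved by any of this.

g17's `relIndex_selmerGroup_relaxed_le_two_pow_padicValNat_tamagawaProduct_twin` is the `W`-side budget in Selmer currency; the pen (v4.5) asks
for the same with `E := Wd`: the generic `relIndex_selmerGroup_relaxed_le_prod_natCard_twoTorsion (E := Wd)` needs only good reduction of `Wd`
at the non-split primes off `d_K` (`hasGoodReductionAt_primePlace_twin_of_ncard_ne_two`, `…RTLadderFrame`) and the identification
`∏_{q∣d_K} #Wd(ℚ_q)[2] = 2^{ord₂ C(Wd)}` (`prod_natCard_twoTorsion_twin_eq_two_pow`, twist invariance of local `2`-torsion counts).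
* `relIndex_selmerGroup_relaxed_twin_le_two_pow_padicValNat_tamagawaProduct` (any sign of `Δ`, with the archimedean intersection);
* `relIndex_selmerGroup_comap_resTorsion_twin_le_two_pow_of_Δ_neg` (bare preimage on `Δ < 0`).

References: [Kramer1981] §2 Prop. 3, Thm. 1; [MazurRubin2010] Prop. 3.3; [SilvermanATAEC1994] IV.9.4.
-/

set_option autoImplicit false
-- the Theorems namespace of this sub repeats the summit name by design (D-0017 nested layout)
set_option linter.dupNamespace false

noncomputable section

open scoped Classical

namespace Summit.BirchSwinnertonDyer.BirchSwinnertonDyer.Theorems.GenusExact.PlusDescent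

open WeierstrassCurve NumberField IsDedekindDomain Rat.HeightOneSpectrum Literature.NumberTheory.EllipticCurves
  Literature.Barriers.BirchSwinnertonDyer

variable (W : WeierstrassCurve ℚ) [W.IsElliptic] [W.IsGloballyMinimal] (K : Type) [Field K] [NumberField K]
  {Wd : WeierstrassCurve ℚ} [Wd.IsElliptic]

/-- **TWIN-SIDE GENUS BUDGET, SELMER CURRENCY: `[res⁻¹(Sel_n(Wd_K/K)) ⊓ ⨅_∞ : Sel_n(Wd/ℚ)] ≤ 2^{ord₂ C(Wd)}`** for every level `n`, on the
LINE 18/19 frame (`W` globally minimal with `C(W)` odd, `K` imaginary quadratic with odd `d_K` and Heegner for `N_W`, `Wd = Cd • W^{(d_K)}`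
elliptic; no sign condition on `Δ`). [cite: Kramer1981, §2 Prop. 3 and Thm. 1] [cite: MazurRubin2010, Prop. 3.3] -/
theorem relIndex_selmerGroup_relaxed_twin_le_two_pow_padicValNat_tamagawaProduct (hIQ : IsImaginaryQuadratic K)
    (hodd : Odd (NumberField.discr K)) (hHe : SatisfiesHeegnerHypothesis (W.conductorNorm ℤ) K) (hT : Odd W.tamagawaProduct)
    (Cd : VariableChange ℚ) (hWd : Cd • W.quadraticTwist (NumberField.discr K : ℚ) = Wd) (n : ℤ) :
    (selmerGroup Wd n).relIndex ((selmerGroup (Wd.baseChange K) n).comap (resTorsion Wd K n) ⊓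
        ⨅ w : InfinitePlace ℚ, selmerLocalKer Wd w.Completion n) ≤ 2 ^ padicValNat 2 Wd.tamagawaProduct := by
  rw [← prod_natCard_twoTorsion_twin_eq_two_pow W hIQ hodd hHe hT Cd hWd]
  exact relIndex_selmerGroup_relaxed_le_prod_natCard_twoTorsion Wd K n hIQ.1 hodd
    fun _ hp hpd hns ↦ hasGoodReductionAt_primePlace_twin_of_ncard_ne_two W K hIQ.1 hodd hHe Cd hWd hp hpd hns

/-- **On `Δ < 0` the bare preimage: `[res⁻¹(Sel_n(Wd_K/K)) : Sel_n(Wd/ℚ)] ≤ 2^{ord₂ C(Wd)}`** (`Δ(Wd) < 0` too, so the real condition is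
automatic, `comap_resTorsion_inf_iInf_eq_of_Δ_neg`). [cite: Kramer1981, §2 Prop. 3 and Thm. 1] -/
theorem relIndex_selmerGroup_comap_resTorsion_twin_le_two_pow_of_Δ_neg (hΔ : W.Δ < 0) (hIQ : IsImaginaryQuadratic K)
    (hodd : Odd (NumberField.discr K)) (hHe : SatisfiesHeegnerHypothesis (W.conductorNorm ℤ) K) (hT : Odd W.tamagawaProduct)
    (Cd : VariableChange ℚ) (hWd : Cd • W.quadraticTwist (NumberField.discr K : ℚ) = Wd) (n : ℤ) :
    (selmerGroup Wd n).relIndex ((selmerGroup (Wd.baseChange K) n).comap (resTorsion Wd K n)) ≤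
      2 ^ padicValNat 2 Wd.tamagawaProduct := by
  rw [← comap_resTorsion_inf_iInf_eq_of_Δ_neg Wd K (Δ_twin_neg W K hΔ Cd hWd) n]
  exact relIndex_selmerGroup_relaxed_twin_le_two_pow_padicValNat_tamagawaProduct W K hIQ hodd hHe hT Cd hWd n

end Summit.BirchSwinnertonDyer.BirchSwinnertonDyer.Theorems.GenusExact.PlusDescent

end
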